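import Summits.AtomisticToContinuum.FouriersLaw.Theorems.EmbeddedDrudeMourreDrudeDissolutionStubRichFrameworkMonomials

/-!
# Stub F `stub_richFramework` of line `kinetic-polymer-gas-on-the-time-axis`, part R-C: summable
space–time clustering and continuity at `0` for the MULTI-TIME MONOMIALS of the local polynomials
(crux `EmbeddedDrudeMourre.DrudeDissolution`, stmt-AtomisticToContinuum-12593; `--supports` file)

For `pinnedChain ω₂ lam β γ` (`ω₂ > 0`, `lam, β ≥ 0`), `T > 0` and the canonical Buttà–Marchioro
dynamics `D` (carrier `bmGood`, measurable flow, identity off `bmGood`, global group law, commuting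
with the translations) there is ONE state `μ` — the transfer-operator Markov Gibbs state of
`exists_gibbsState_mixing_pinnedChain` (DLR at `T`, shift/reflection invariant, superstable,
exponentially `ρ`-mixing) — in which for ALL multi-time monomials `M, M'` (elements of the monoid
generated by `{u ∘ φ_s : u ∈ 𝒫}`): `Σ_x |Cov_μ(M, M' ∘ τ_x)| < ∞`, and
`t ↦ Σ_x Cov_μ(M, (M ∘ τ_x) ∘ φ_t)` is continuous at `0` (`richFramework_clustering`, registered).

Proof: the weighted `L¹`-locality package of part R-M gives, for the pair `(M, M' ∘ φ_t)`, `|t| ≤ 1`,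
box-local approximants `(h_M 0 n, h_{M'} t n)` with
`|Cov(M, (M'∘φ_t)∘τ_x) - Cov(h, h'∘τ_x)| ≤ |Cov(M - h, Y)| + |Cov(h∘τ_{-x} , M'∘φ_t - h')| ≤ ε n`
UNIFORMLY in `x` and `t` (`|Cov(X, Y)| ≤ ∫ |X| |Y - EY|`, the centred partner being the weight);
the two-sided transfer of part R-T turns this into a summable majorant, uniform for `|t| ≤ 1`;
termwise continuity is the tree's Vitali two-point continuity; dominated convergence for series.
-/

noncomputable section

open MeasureTheory ProbabilityTheory Set Filter Topology Function Real
open scoped InnerProductSpace ENNReal BigOperators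
open Literature.MathematicalPhysics.KineticTheory
open Literature.MathematicalPhysics.KineticTheory.HeatConduction
open Summit.AtomisticToContinuum.FouriersLaw.Theorems.DrudeDissolution.GramPencilHarmonicChaos

namespace Summit.AtomisticToContinuum.FouriersLaw.Theorems.DrudeDissolution.KineticPolymerGasOnTheTimeAxis

variable {P : OscillatorChain}

/-- `L²` from the second absolute moment. [folklore] -/
theorem memLp_two_of_abs_sq {μ : Measure ChainConfig} {f : ChainConfig → ℝ} (hf : Measurable f)
    (h2 : Integrable (fun σ => |f σ| ^ 2) μ) : MemLp f 2 μ :=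
  (memLp_two_iff_integrable_sq hf.aestronglyMeasurable).2 (by simpa only [sq_abs] using h2)

/-- **The monoid of multi-time monomials is translation stable** (`(u ∘ φ_s) ∘ τ_x = (u ∘ τ_x) ∘ φ_s`
when the flow commutes with the translations). [folklore] -/
theorem comp_chainShift_mem_closure (D : InfiniteChainDynamics P)
    (hsh : ∀ (t : ℝ) (x : ℤ), D.flow t ∘ chainShift x = chainShift x ∘ D.flow t) (x : ℤ)
    {M : ChainConfig → ℝ}
    (hM : M ∈ Submonoid.closure {w : (ℤ → ℝ × ℝ) → ℝ | ∃ u ∈ Algebra.adjoin ℝ (Set.range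
      fun xc : ℤ × Bool => fun σ : ChainConfig => if xc.2 then (σ xc.1).2 else (σ xc.1).1),
      ∃ s : ℝ, w = u ∘ D.flow s}) :
    M ∘ chainShift x ∈ Submonoid.closure {w : (ℤ → ℝ × ℝ) → ℝ | ∃ u ∈ Algebra.adjoin ℝ (Set.range
      fun xc : ℤ × Bool => fun σ : ChainConfig => if xc.2 then (σ xc.1).2 else (σ xc.1).1),
      ∃ s : ℝ, w = u ∘ D.flow s} := by
  induction hM using Submonoid.closure_induction with
  | mem o ho =>
    obtain ⟨u, hu, s, rfl⟩ := ho
    refine Submonoid.subset_closure ⟨u ∘ chainShift x, comp_chainShift_mem_polyObs x hu, s, ?_⟩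
    rw [Function.comp_assoc, hsh s x]
    rfl
  | one => exact Submonoid.one_mem _
  | mul M₁ M₂ _ _ ih₁ ih₂ => exact Submonoid.mul_mem _ ih₁ ih₂

/-- **Uniform covariance-approximability of a pair of multi-time monomials by box-local pairs.**
From the weighted `L¹`-locality packages of `M` and `M'` (part R-M): a margin `K`, a level `G` and a
summable `ε ≥ 0` such that for all `|t| ≤ 1` and `n` the box-local pair `(h_M 0 n, h_{M'} t n)`
satisfies `|Cov(M, (M' ∘ φ_t) ∘ τ_x) - Cov(h, h' ∘ τ_x)| ≤ ε n` for every `x`. [folklore] -/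
theorem richFramework_approx (D : InfiniteChainDynamics P) (μ : Measure ChainConfig)
    [IsProbabilityMeasure μ] (hflow : ∀ t, MeasurePreserving (D.flow t) μ μ)
    (hτ : ∀ x : ℤ, MeasurePreserving (chainShift x) μ μ) (h0 : D.flow 0 = id)
    {M M' : ChainConfig → ℝ}
    (hM : (Measurable M ∧ (∀ j : ℕ, MeasureTheory.Integrable (fun σ => |M σ| ^ j) μ) ∧ ∃ (K k : ℕ) (h : ℝ → ℕ → (ℤ → ℝ × ℝ) → ℝ), 2 ≤ k ∧ (∀ (t : ℝ) (n : ℕ), DependsOn (h t n) (Set.Icc (-((n + K : ℕ) : ℤ)) (n + K : ℕ)) ∧ Measurable (h t n)) ∧ (∀ j : ℕ, ∃ A : ℝ, ∀ (t : ℝ) (n : ℕ), MeasureTheory.Integrable (fun σ => |h t n σ| ^ j) μ ∧ MeasureTheory.integral μ (fun σ => |h t n σ| ^ j) ≤ A) ∧ (∀ B : ℝ, ∃ δ : ℕ → ℝ, (∀ n, 0 ≤ δ n) ∧ Summable δ ∧ ∀ t : ℝ, |t| ≤ 1 → ∀ (n : ℕ) (W : (ℤ → ℝ × ℝ) → ℝ),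 Measurable W → MeasureTheory.Integrable (fun σ => |W σ| ^ k) μ → MeasureTheory.integral μ (fun σ => |W σ| ^ k) ≤ B → MeasureTheory.integral μ (fun σ => |M (D.flow t σ) - h t n σ| * |W σ|) ≤ δ n)))
    (hM' : (Measurable M' ∧ (∀ j : ℕ, MeasureTheory.Integrable (fun σ => |M' σ| ^ j) μ) ∧ ∃ (K k : ℕ) (h : ℝ → ℕ → (ℤ → ℝ × ℝ) → ℝ), 2 ≤ k ∧ (∀ (t : ℝ) (n : ℕ), DependsOn (h t n) (Set.Icc (-((n + K : ℕ) : ℤ)) (n + K : ℕ)) ∧ Measurable (h t n)) ∧ (∀ j : ℕ, ∃ A : ℝ, ∀ (t : ℝ) (n : ℕ), MeasureTheory.Integrable (fun σ => |h t n σ| ^ j) μ ∧ MeasureTheory.integral μ (fun σ => |h t n σ| ^ j) ≤ A) ∧ (∀ B : ℝ, ∃ δ : ℕ → ℝ, (∀ n, 0 ≤ δ n) ∧ Summable δ ∧ ∀ t : ℝ, |t| ≤ 1 → ∀ (n : ℕ) (W : (ℤ → ℝ × ℝ) → ℝ), Measurable W → MeasureTheory.Integrable (fun σ => |W σ| ^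 k) μ → MeasureTheory.integral μ (fun σ => |W σ| ^ k) ≤ B → MeasureTheory.integral μ (fun σ => |M' (D.flow t σ) - h t n σ| * |W σ|) ≤ δ n))) :
    ∃ (K : ℕ) (G : ℝ) (ε : ℕ → ℝ), (∀ n, 0 ≤ ε n) ∧ Summable ε ∧ ∀ t : ℝ, |t| ≤ 1 → ∀ n : ℕ,
      ∃ h h' : (ℤ → ℝ × ℝ) → ℝ, DependsOn h (Set.Icc (-((n + K : ℕ) : ℤ)) (n + K : ℕ)) ∧
        DependsOn h' (Set.Icc (-((n + K : ℕ) : ℤ)) (n + K : ℕ)) ∧ Measurable h ∧ Measurable h' ∧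
        MemLp h 2 μ ∧ MemLp h' 2 μ ∧ Real.sqrt (∫ σ, h σ ^ 2 ∂μ) ≤ G ∧
        Real.sqrt (∫ σ, h' σ ^ 2 ∂μ) ≤ G ∧
        ∀ x : ℤ, |cov[M, (M' ∘ D.flow t) ∘ chainShift x; μ] - cov[h, h' ∘ chainShift x; μ]| ≤ ε n := by
  obtain ⟨hm, hmom, K₁, k₁, g₁, hk₁, hloc1, hA1, hδ1⟩ := hM
  obtain ⟨hm', hmom', K₂, k₂, g₂, hk₂, hloc2, hA2, hδ2⟩ := hM'
  -- `L²` sizes of the approximants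
  obtain ⟨S₁, hS₁⟩ := hA1 2
  obtain ⟨S₂, hS₂⟩ := hA2 2
  -- the two moment budgets and the rates
  obtain ⟨δ₁, hδ₁0, hδ₁s, hδ₁⟩ :=
    hδ1 (2 ^ (k₁ - 1) * ((∫ σ, |M' σ| ^ k₁ ∂μ) + |∫ σ, M' σ ∂μ| ^ k₁))
  obtain ⟨A₁, hA₁⟩ := hA1 1
  obtain ⟨A, hA⟩ := hA1 k₂
  obtain ⟨δ₂, hδ₂0, hδ₂s, hδ₂⟩ := hδ2 (2 ^ (k₂ - 1) * (A + A₁ ^ k₂))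
  refine ⟨max K₁ K₂, max (Real.sqrt S₁) (Real.sqrt S₂), fun n => δ₁ n + δ₂ n,
    fun n => add_nonneg (hδ₁0 n) (hδ₂0 n), hδ₁s.add hδ₂s, fun t ht n => ?_⟩
  have hg1m : Measurable (g₁ 0 n) := (hloc1 0 n).2
  have hg2m : Measurable (g₂ t n) := (hloc2 t n).2
  have hg1L : MemLp (g₁ 0 n) 2 μ := memLp_two_of_abs_sq hg1m (hS₁ 0 n).1
  have hg2L : MemLp (g₂ t n) 2 μ := memLp_two_of_abs_sq hg2m (hS₂ t n).1
  refine ⟨g₁ 0 n, g₂ t n, ?_, ?_, hg1m, hg2m, hg1L, hg2L, ?_, ?_, fun x => ?_⟩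
  · exact (hloc1 0 n).1.mono (Icc_subset_Icc (by push_cast; omega) (by push_cast; omega))
  · exact (hloc2 t n).1.mono (Icc_subset_Icc (by push_cast; omega) (by push_cast; omega))
  · refine le_trans (Real.sqrt_le_sqrt ?_) (le_max_left _ _)
    simpa only [sq_abs] using (hS₁ 0 n).2
  · refine le_trans (Real.sqrt_le_sqrt ?_) (le_max_right _ _)
    simpa only [sq_abs] using (hS₂ t n).2
  -- the estimate, uniformly in `x`
  have hML : MemLp M 2 μ := memLp_two_of_abs_sq hm (hmom 2)
  have hM'L : MemLp M' 2 μ := memLp_two_of_abs_sq hm' (hmom' 2)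
  set Y : ChainConfig → ℝ := (M' ∘ D.flow t) ∘ chainShift x with hY
  have hYS : MeasurePreserving (D.flow t ∘ chainShift x) μ μ := (hflow t).comp (hτ x)
  have hYm : Measurable Y := hm'.comp hYS.measurable
  have hYL : MemLp Y 2 μ := hM'L.comp_measurePreserving hYS
  have hYmom : ∀ j, Integrable (fun σ => |Y σ| ^ j) μ ∧ ∫ σ, |Y σ| ^ j ∂μ = ∫ σ, |M' σ| ^ j ∂μ :=
    fun j => ⟨hYS.integrable_comp_of_integrable (hmom' j),
      integral_comp_eq_of_measurePreserving hYS (F := fun σ => |M' σ| ^ j) (hmom' j).aestronglyMeasurable⟩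
  have hYmean : ∫ σ, Y σ ∂μ = ∫ σ, M' σ ∂μ :=
    integral_comp_eq_of_measurePreserving hYS hm'.aestronglyMeasurable
  have hg2xL : MemLp (g₂ t n ∘ chainShift x) 2 μ := hg2L.comp_measurePreserving (hτ x)
  -- split the difference of covariances
  have hsplit : cov[M, Y; μ] - cov[g₁ 0 n, g₂ t n ∘ chainShift x; μ] =
      cov[M - g₁ 0 n, Y; μ] + cov[g₁ 0 n, Y - g₂ t n ∘ chainShift x; μ] := by
    rw [covariance_sub_left hML hg1L hYL, covariance_sub_right hg1L hYL hg2xL]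
    ring
  -- first term: weight `Y - EY`, estimate of `M` at time `0`
  have h1 : |cov[M - g₁ 0 n, Y; μ]| ≤ δ₁ n := by
    refine (abs_covariance_le_integral_abs_mul (hML.sub hg1L) hYL).trans ?_
    obtain ⟨hWi, hWle⟩ := integral_abs_sub_const_pow_le hYm k₁ (hYmom k₁).1 (∫ σ, Y σ ∂μ)
    have e : ∀ σ, (M - g₁ 0 n) σ = M (D.flow 0 σ) - g₁ 0 n σ := fun σ => by
      rw [h0]; rfl
    simp only [e]
    refine hδ₁ 0 (by simp) n (fun σ => Y σ - ∫ σ', Y σ' ∂μ) (hYm.sub measurable_const) hWi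
      (hWle.trans (le_of_eq ?_))
    rw [(hYmom k₁).2, hYmean]
  -- second term: move `τ_x` to the other side, weight `g₁ ∘ τ_{-x} - E g₁`, estimate of `M'` at time `t`
  have h2 : |cov[g₁ 0 n, Y - g₂ t n ∘ chainShift x; μ]| ≤ δ₂ n := by
    have hgx : MeasurePreserving (chainShift (-x)) μ μ := hτ (-x)
    have e1 : Y - g₂ t n ∘ chainShift x = (fun σ => M' (D.flow t σ) - g₂ t n σ) ∘ chainShift x := rfl
    have e2 : g₁ 0 n = (g₁ 0 n ∘ chainShift (-x)) ∘ chainShift x := by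
      rw [Function.comp_assoc, ShiftAction.neg_comp]; rfl
    have hZm : Measurable fun σ => M' (D.flow t σ) - g₂ t n σ := (hm'.comp (hflow t).measurable).sub hg2m
    have hZL : MemLp (fun σ => M' (D.flow t σ) - g₂ t n σ) 2 μ :=
      (hM'L.comp_measurePreserving (hflow t)).sub hg2L
    have hg1xL : MemLp (g₁ 0 n ∘ chainShift (-x)) 2 μ := hg1L.comp_measurePreserving hgx
    rw [e1, e2, covariance_comp_measurePreserving (hτ x) hg1xL.aestronglyMeasurable hZL.aestronglyMeasurable,
      covariance_comm]
    refine (abs_covariance_le_integral_abs_mul hZL hg1xL).trans ?_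
    have hWm : Measurable (g₁ 0 n ∘ chainShift (-x)) := hg1m.comp (chainShift.measurable (-x))
    have hWmom : Integrable (fun σ => |(g₁ 0 n ∘ chainShift (-x)) σ| ^ k₂) μ ∧
        ∫ σ, |(g₁ 0 n ∘ chainShift (-x)) σ| ^ k₂ ∂μ = ∫ σ, |g₁ 0 n σ| ^ k₂ ∂μ :=
      ⟨hgx.integrable_comp_of_integrable (hA 0 n).1,
        integral_comp_eq_of_measurePreserving hgx (F := fun σ => |g₁ 0 n σ| ^ k₂) (hA 0 n).1.aestronglyMeasurable⟩
    have hmean : ∫ σ, (g₁ 0 n ∘ chainShift (-x)) σ ∂μ = ∫ σ, g₁ 0 n σ ∂μ :=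
      integral_comp_eq_of_measurePreserving hgx hg1m.aestronglyMeasurable
    obtain ⟨hWi, hWle⟩ := integral_abs_sub_const_pow_le hWm k₂ hWmom.1 (∫ σ, (g₁ 0 n ∘ chainShift (-x)) σ ∂μ)
    refine hδ₂ t ht n (fun σ => (g₁ 0 n ∘ chainShift (-x)) σ - ∫ σ', (g₁ 0 n ∘ chainShift (-x)) σ' ∂μ)
      (hWm.sub measurable_const) hWi (hWle.trans ?_)
    rw [hWmom.2, hmean]
    have hmean_le : |∫ σ, g₁ 0 n σ ∂μ| ≤ A₁ := by
      refine (abs_integral_le_integral_abs).trans ?_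
      simpa only [pow_one] using (hA₁ 0 n).2
    have hp : |∫ σ, g₁ 0 n σ ∂μ| ^ k₂ ≤ A₁ ^ k₂ := pow_le_pow_left₀ (abs_nonneg _) hmean_le k₂
    have h2pos : (0 : ℝ) ≤ 2 ^ (k₂ - 1) := by positivity
    nlinarith [(hA 0 n).2]
  calc |cov[M, Y; μ] - cov[g₁ 0 n, g₂ t n ∘ chainShift x; μ]|
      = |cov[M - g₁ 0 n, Y; μ] + cov[g₁ 0 n, Y - g₂ t n ∘ chainShift x; μ]| := by rw [hsplit]
    _ ≤ |cov[M - g₁ 0 n, Y; μ]| + |cov[g₁ 0 n, Y - g₂ t n ∘ chainShift x; μ]| := abs_add_le _ _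
    _ ≤ δ₁ n + δ₂ n := add_le_add h1 h2

/-- **Part R-C of stub F (registered helper): summable space–time clustering and continuity at `0`
for all multi-time monomials, in the transfer-operator Gibbs state.** For `pinnedChain ω₂ lam β γ`
(`ω₂ > 0`, `lam, β ≥ 0`), `T > 0` and the canonical Buttà–Marchioro dynamics `D` (carrier `bmGood`,
measurable flow, identity off `bmGood`, global group law, commuting with the translations): a DLR
Gibbs state `μ` at `T`, shift invariant, superstable, invariant under `σ ↦ σ(-·)` and under the
flow, such that for all `M, M'` in the monoid generated by `{u ∘ φ_s : u ∈ 𝒫}`,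
`x ↦ |Cov_μ(M, M' ∘ τ_x)|` is summable and `t ↦ Σ_x Cov_μ(M, (M ∘ τ_x) ∘ φ_t)` is continuous at `0`.
[cite: ButtaMarchioro2016, §2 Thm 2.1–2.2 and §3] -/
theorem richFramework_clustering : ∀ (ω₂ lam β γ : ℝ), 0 < ω₂ → 0 ≤ lam → 0 ≤ β → ∀ T : ℝ, 0 < T → ∀ D : Literature.MathematicalPhysics.KineticTheory.HeatConduction.InfiniteChainDynamics (Literature.MathematicalPhysics.KineticTheory.HeatConduction.pinnedChain ω₂ lam β γ), D.carrier = (Literature.MathematicalPhysics.KineticTheory.HeatConduction.pinnedChain ω₂ lam β γ).bmGood → (∀ t : ℝ, Measurable (D.flow t)) → (∀ (t : ℝ) (σ : ℤ → ℝ × ℝ), σ ∉ (Literature.MathematicalPhysics.KineticTheory.HeatConduction.pinnedChain ω₂ lam β γ).bmGood → D.flow t σ = σ) → (∀ t s : ℝ, D.flow (t + s) = D.flow t ∘ D.flow s) → (∀ (t : ℝ) (x : ℤ), D.flow t ∘ Literature.MathematicalPhysics.KineticTheory.HeatConduction.chainShift x = Literature.MathematicalPhysics.KineticTheory.HeatConduction.chainShift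 x ∘ D.flow t) → ∃ μ : MeasureTheory.Measure (ℤ → ℝ × ℝ), (Literature.MathematicalPhysics.KineticTheory.HeatConduction.pinnedChain ω₂ lam β γ).IsChainGibbsMeasure T μ ∧ Literature.MathematicalPhysics.KineticTheory.HeatConduction.IsShiftInvariant μ ∧ (Literature.MathematicalPhysics.KineticTheory.HeatConduction.pinnedChain ω₂ lam β γ).HasSuperstabilityEstimate μ ∧ μ.map (fun (σ : ℤ → ℝ × ℝ) (x : ℤ) => σ (-x)) = μ ∧ D.PreservesMeasure μ ∧ (∀ M ∈ Submonoid.closure {w : (ℤ → ℝ × ℝ) → ℝ | ∃ u ∈ Algebra.adjoin ℝ (Set.range fun xc : ℤ × Bool => fun σ : Literature.MathematicalPhysics.KineticTheory.HeatConduction.ChainConfig => if xc.2 then (σ xc.1).2 else (σ xc.1).1), ∃ s : ℝ, w = u ∘ D.flow s}, ∀ M' ∈ Submonoid.closure {w : (ℤ → ℝ × ℝ) → ℝ | ∃ u ∈ Algebra.adjoin ℝ (Set.range fun xc : ℤ × Bool => fun σ : Literature.MathematicalPhysics.KineticTheory.HeatConduction.ChainConfig => if xc.2 then (σ xc.1).2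 else (σ xc.1).1), ∃ s : ℝ, w = u ∘ D.flow s}, Summable fun x : ℤ => |ProbabilityTheory.covariance M (M' ∘ Literature.MathematicalPhysics.KineticTheory.HeatConduction.chainShift x) μ|) ∧ (∀ M ∈ Submonoid.closure {w : (ℤ → ℝ × ℝ) → ℝ | ∃ u ∈ Algebra.adjoin ℝ (Set.range fun xc : ℤ × Bool => fun σ : Literature.MathematicalPhysics.KineticTheory.HeatConduction.ChainConfig => if xc.2 then (σ xc.1).2 else (σ xc.1).1), ∃ s : ℝ, w = u ∘ D.flow s}, ContinuousAt (fun t : ℝ => ∑' x : ℤ, ProbabilityTheory.covariance M ((M ∘ Literature.MathematicalPhysics.KineticTheory.HeatConduction.chainShift x) ∘ D.flow t) μ) 0) := by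
  intro ω₂ lam β γ hω hl hβ T hT D hcar hmeas hid hgrp hsh
  obtain ⟨s₁, hs₁, hU1⟩ := exists_isEvenPolyOfDegree_U_pinnedChain β γ hω hl
  obtain ⟨s₂, hs₂, hV1⟩ := exists_isEvenPolyOfDegree_V_pinnedChain ω₂ lam γ hβ
  have hU0 : ∀ r, 0 ≤ (pinnedChain ω₂ lam β γ).U r := hU1.choose_spec.2.2
  have hV0 : ∀ r, 0 ≤ (pinnedChain ω₂ lam β γ).V r := hV1.choose_spec.2.2
  obtain ⟨μ, hG, hS, hss, hrefl, C, m, hm, hmix⟩ :=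
    MourreDissolution.exists_gibbsState_mixing_pinnedChain ω₂ lam β γ hω hl hβ T hT
  haveI : IsProbabilityMeasure μ := hG.isProbabilityMeasure
  have hD : D.PreservesMeasure μ :=
    OscillatorChain.preservesMeasure_of_carrier_eq_bmGood hs₁ hs₂ hU1 hV1 D hcar hmeas hG hss
  have hτ : ∀ x : ℤ, MeasurePreserving (chainShift x) μ μ := hS.measurePreserving_chainShift
  have h0 : D.flow 0 = id := by
    funext σ
    by_cases hσ : σ ∈ (pinnedChain ω₂ lam β γ).bmGood
    · exact D.flow_zero σ (by rw [hcar]; exact hσ)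
    · exact hid 0 σ hσ
  have hpkg := richFramework_monomials ω₂ lam β γ hω hl hβ T hT D hcar hmeas hid hgrp μ hG hS hss
  -- the uniform majorant for a pair `(M, M')`
  have hmaj : ∀ M ∈ Submonoid.closure {w : (ℤ → ℝ × ℝ) → ℝ | ∃ u ∈ Algebra.adjoin ℝ (Set.range
      fun xc : ℤ × Bool => fun σ : ChainConfig => if xc.2 then (σ xc.1).2 else (σ xc.1).1),
      ∃ s : ℝ, w = u ∘ D.flow s}, ∀ M' ∈ Submonoid.closure {w : (ℤ → ℝ × ℝ) → ℝ | ∃ u ∈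
      Algebra.adjoin ℝ (Set.range fun xc : ℤ × Bool => fun σ : ChainConfig =>
      if xc.2 then (σ xc.1).2 else (σ xc.1).1), ∃ s : ℝ, w = u ∘ D.flow s},
      ∃ F : ℤ → ℝ, Summable F ∧ ∀ t : ℝ, |t| ≤ 1 → ∀ x : ℤ,
        |cov[M, (M' ∘ D.flow t) ∘ chainShift x; μ]| ≤ F x := by
    intro M hM M' hM'
    obtain ⟨K, G, ε, hε0, hε, happ⟩ := richFramework_approx D μ hD.2 hτ h0 (hpkg M hM) (hpkg M' hM')
    obtain ⟨F, hF, hFb⟩ := richFramework_transfer μ C m hm hmix hτ K G ε hε0 hε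
    exact ⟨F, hF, fun t ht x => hFb (fun x => cov[M, (M' ∘ D.flow t) ∘ chainShift x; μ])
      (fun n => happ t ht n) x⟩
  refine ⟨μ, hG, hS, hss, hrefl, hD, fun M hM M' hM' => ?_, fun M hM => ?_⟩
  · -- summable clustering (`t = 0`)
    obtain ⟨F, hF, hFb⟩ := hmaj M hM M' hM'
    refine Summable.of_nonneg_of_le (fun x => abs_nonneg _) (fun x => ?_) hF
    have := hFb 0 (by simp) x
    rwa [h0, Function.comp_id] at this
  · -- continuity at `0` (dominated convergence for series)
    obtain ⟨F, hF, hFb⟩ := hmaj M hM M hM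
    have e : ∀ (t : ℝ) (x : ℤ), cov[M, (M ∘ chainShift x) ∘ D.flow t; μ] =
        cov[M, (M ∘ D.flow t) ∘ chainShift x; μ] := fun t x => by
      rw [comp_chainShift_comp_eq (hsh t x)]
    simp only [e]
    refine tendsto_tsum_of_dominated_convergence hF (fun x => ?_) ?_
    · -- termwise continuity (Vitali two-point continuity of the tree)
      obtain ⟨hMm, hMmom, -⟩ := hpkg M hM
      have hMx := comp_chainShift_mem_closure D hsh x hM
      obtain ⟨hMxm, hMxmom, -⟩ := hpkg _ hMx
      have hM4 : Integrable (fun σ => M σ ^ 4) μ := by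
        refine (hMmom 4).congr (Eventually.of_forall fun σ => ?_)
        exact Even.pow_abs (by decide) _
      have hMx4 : Integrable (fun σ => (M ∘ chainShift x) σ ^ 4) μ := by
        refine (hMxmom 4).congr (Eventually.of_forall fun σ => ?_)
        exact Even.pow_abs (by decide) _
      have hc : Continuous fun t : ℝ => ∫ σ, M σ * (M ∘ chainShift x) (D.flow t σ) ∂μ :=
        D.continuous_integral_mul_comp_flow hD hMm hMxm hM4 hMx4 fun σ hσ =>
          continuous_comp_flow_of_mem_closure D hgrp hMx hσ
      have hML : MemLp M 2 μ := memLp_two_of_abs_sq hMm (hMmom 2)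
      have hMxL : MemLp (M ∘ chainShift x) 2 μ := memLp_two_of_abs_sq hMxm (hMxmom 2)
      have hterm : (fun t : ℝ => cov[M, (M ∘ D.flow t) ∘ chainShift x; μ]) = fun t : ℝ =>
          (∫ σ, M σ * (M ∘ chainShift x) (D.flow t σ) ∂μ) -
            (∫ σ, M σ ∂μ) * ∫ σ, (M ∘ chainShift x) σ ∂μ := by
        funext t
        rw [← comp_chainShift_comp_eq (hsh t x),
          covariance_eq_sub hML (hMxL.comp_measurePreserving (hD.2 t))]
        have hmean : ∫ σ, ((M ∘ chainShift x) ∘ D.flow t) σ ∂μ = ∫ σ, (M ∘ chainShift x) σ ∂μ :=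
          integral_comp_eq_of_measurePreserving (hD.2 t) hMxm.aestronglyMeasurable
        rw [hmean]
        rfl
      have hca : Continuous fun t : ℝ => cov[M, (M ∘ D.flow t) ∘ chainShift x; μ] := by
        rw [hterm]
        exact hc.sub continuous_const
      exact hca.tendsto 0
    · have h1 : ∀ᶠ t in 𝓝 (0 : ℝ), |t| ≤ 1 := by
        filter_upwards [Icc_mem_nhds (show (-1 : ℝ) < 0 by norm_num) (show (0 : ℝ) < 1 by norm_num)]
          with t ht
        exact abs_le.2 ⟨ht.1, ht.2⟩
      filter_upwards [h1] with t ht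
      intro x
      rw [Real.norm_eq_abs]
      exact hFb t ht x

end Summit.AtomisticToContinuum.FouriersLaw.Theorems.DrudeDissolution.KineticPolymerGasOnTheTimeAxis

end
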